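import Mathlib
import Summits.ValiantsHypothesis.ValiantsHypothesis.Theorems.LacunarySymmetroidMatrixDescartesCensusDefs
import Summits.ValiantsHypothesis.ValiantsHypothesis.Theorems.LacunarySymmetroidMatrixDescartesCensusFrame
import Summits.ValiantsHypothesis.ValiantsHypothesis.Theorems.LacunarySymmetroidMatrixDescartesCensusKLawBridge
import Summits.ValiantsHypothesis.ValiantsHypothesis.Theorems.KPlusLogSqLawWeakLiftingWindow
import Summits.ValiantsHypothesis.ValiantsHypothesis.Theorems.MatrixDescartes.Negative.MatrixDescartesWitness24
import Summits.ValiantsHypothesis.ValiantsHypothesis.Theorems.LacunarySymmetroidMatrixDescartesOsculationLawTwoK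
import Summits.ValiantsHypothesis.ValiantsHypothesis.Theorems.LacunarySymmetroidMatrixDescartesOsculationLawThreeK
import Summits.ValiantsHypothesis.ValiantsHypothesis.Theorems.LacunarySymmetroidMatrixDescartesOsculationLawFourK
import Summits.ValiantsHypothesis.ValiantsHypothesis.Theorems.LacunarySymmetroidMatrixDescartesOsculationLawUniformAll
import Summits.ValiantsHypothesis.ValiantsHypothesis.Theorems.LacunarySymmetroidMatrixDescartesOsculationLawUniformMultichoose
import Summits.ValiantsHypothesis.ValiantsHypothesis.Theorems.LacunarySymmetroidMatrixDescartesOsculationLawWindow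
import Summits.ValiantsHypothesis.ValiantsHypothesis.Theorems.LacunarySymmetroidMatrixDescartesOsculationLawWindowReduction
import Summits.ValiantsHypothesis.ValiantsHypothesis.Theorems.LacunarySymmetroidMatrixDescartesOsculationLawPeelRankOne
import Summits.ValiantsHypothesis.ValiantsHypothesis.Theorems.LacunarySymmetroidMatrixDescartesOsculationLawPeelRankTwo
import Summits.ValiantsHypothesis.ValiantsHypothesis.Theorems.LacunarySymmetroidMatrixDescartesOsculationLawPeelRankThreeUp
import Summits.ValiantsHypothesis.ValiantsHypothesis.Theorems.LacunarySymmetroidMatrixDescartesOsculationLawStubRankOne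
import Summits.ValiantsHypothesis.ValiantsHypothesis.Theorems.LacunarySymmetroidMatrixDescartesOsculationLawRecursionHolds
import Summits.ValiantsHypothesis.ValiantsHypothesis.Theses.LacunarySymmetroid

/-!
# val-idea-2 (g2) — LINE «osculation-law» (crux `Theses.LacunarySymmetroid.MatrixDescartes`, stmt-18050, via Conjecture B)

Lens: discriminant / resultant stratification.  Object: the **A₂ (cusp) stratum** of the two–parameter
discriminant of INSERTING ONE SEMIDEFINITE LETTER.

For a symmetric block pencil `G(t) = Σ_l t^(d l) S l` on `Fin r ⊕ Fin s` and the block projector `P = I_r ⊕ 0`,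
the real curve `C(G,P) = {(t,b) : t > 0, b < 0, det(G(t) + b P) = 0}` is a union of real-analytic GRAPHS
(the `b`-roots are minus the eigenvalues of the Schur complement `G/G₂₂(t)`, all real because `G` is symmetric).
The pencil with the inserted letter, `F = G + c t^N P` (`c > 0`, any position `N`), is singular at `t` iff the
curve meets the monomial arc `b = -c t^N`, which is a STRAIGHT LINE in the coordinates `(log t, log |b|)`.
A line meets a log-log-inflection-free arc of a graph at most twice, so

  `Z₊(det F) ≤ 2·ι⁻(G,P) + 2r + 2·Z₊(det G) + 3·Z₊(det G₂₂)`   (multiplicity currency; uniformly in `c`, `N`)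

where `ι⁻(G,P)` = number of log-log inflection points of `C(G,P)` = the positive solutions of the resultant-type
system `{Φ = 0, H(Φ) = 0}` (`Φ(t,b) = det(G(t)+bP)`, `H` = bordered log-Hessian) = the CUSPS of the dual curve =
the points `(c,N)` at which `det(G + c t^N P)` acquires a TRIPLE zero.  The coefficient in front of `Z₊(det G)`
is an absolute constant, so peeling the letters one semidefinite part at a time is an additive/`2^{O(K)}`
recursion, and Conjecture B follows from the format-level law

  `OsculationLaw : ∃ C, ∀ m K, ι⁻ ≤ 2^(C (K + log₂² m))` for every symmetric `(m,K)` block pencil.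

Stubs (sorried, each a genuine lemma of the line): `stub_peel` (the convexity inequality, L), `stub_rankOne`
(`r = 1`: `ι⁻ ≤ Z₊(W(f)·a² − W(a)·f²)`, the explicit resultant form, M), `stub_osculationLaw` (the LAW, open),
`stub_recursion` (spectral split + congruence + induction on `K` + general position, M/L).
Composition `matrixDescartes_of_stubs` is kernel-checked (no sorry) and concludes the crux BY NAME through the
tree theorems `Theorems.LacunarySymmetroidMatrixDescartes.Census.realRootLawAt_of_posRootLawAt`, `KPlusLogSqLaw.kPlusLogSqLaw_offWindow` (K = 0 corner) and
`Census.matrixDescartes_of_kPlusLogSqLaw`.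

WIRING 2026-08-28T11:30Z (val-port-2 g1, line-file writer per desk RULING #281 (c) / #283 (i); δ only): `stub_peelRankThreeUp`
:= val-lit-p7 g13's `OsculationPeel.peelInequality_rank_of_three_le` (p628379) ⇒ `stub_peel : PeelInequality` is SORRY-FREE;
the file's sorries are 2 = {`stub_osculationLaw` (the LAW, the crux), `stub_recursion`}.  18050 OPEN; VP ≠ VNP NOT proved.
WIRING 2026-08-28T11:50Z (val-port-2 g1, desk RULING #286; δ only): `rungAll := OsculationUniformRung.osculationLawAt_all` (p629687,
val-lit-p5 g12) — the ALL-`m` rung `OsculationLawAt m K (m·K^{20m²})`; NOT the law; sorries stay 2.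
WIRING 2026-08-28 (val-port-2 g1, desk RULING #287 (b); δ only): `stub_recursion (hP) (hO) := GPDensity.recursion_holds hP hO`
(val-port-3 g1's ROUTE′ closer, `Theorems/…OsculationLawRecursionHolds.lean`) ⇒ `stub_recursion` is a THEOREM given its two
hypotheses; the file's sorries are 1 = {`stub_osculationLaw`} = THE LAW = THE CRUX.  18050 OPEN; VP ≠ VNP NOT proved.
WIRING 2026-08-28T16:5xZ (val-port-2 g2, line-file pen of record per desk RULING #293 (b) / director R262; δ only, landed by-name
closers): `rungOffWindow` / `rungBoundedK` := val-lit-p7 g14's `OsculationWindow.osculationLawAt_offWindow` / `osculationLawAt_of_le`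
(p644942) and `osculationLaw_iff_window` (⇐ := `OsculationWindow.osculationLaw_of_window`, p7 g14's `…WindowReduction`; ⇒ trivial):
THE LAW IS EQUIVALENT TO ITS RESTRICTION TO THE WINDOW `log₂ m < K < 20 m²` — the calibration of record for the b122 idea wave
(p5 g12 memo `NOTE-p5g12-18050-LAW-calibration.md`).  No stub touched; sorries stay 1 = {`stub_osculationLaw`}; 18050 OPEN; VP ≠ VNP NOT proved.
LANDED RESTRICTED-CLASS RESULTS toward `stub_osculationLaw` (director R260 (b) re-pointing, roster R2664 O1–O5; TEXT CREDIT ONLY per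
desk RULING #295 (b) / #304 — they carry an extra class hypothesis, so they are NOT `OsculationLawAt` instances and get no `rung*`
theorem here): O1 COMMUTING/DIAGONAL — engine `OsculationCommuting.sheetProduct_count` (val-lit-p5 g13, p644367; generic form p646236),
matrix layer `osculationLawAt_diagonal` / `osc_diagonal_le` (every splitting, `IsDiag`), `osculationLawAt_commuting_top`,
`osculationLawAt_commuting` (pairwise `Commute`, block/orthogonal reduction) — val-port-4 g2, p644962 `…OsculationCommutingDiagonal`,
p645705 `…OsculationCommutingTop`, p646204 `…OsculationCommuting`, p646205 `…OsculationCommutingBlock`; bound `r·(C(K,2) − 1) + C(r,2)·(K − 1)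
≤ m·K² + m²·K`.  O2 RANK-ONE sheets engine — p648657 `…OsculationLawRankOneSheets` (val-lit-p5 g13); rank-one follow-ups (TEXT credit,
restricted class `Fin m ⊕ Fin 0`): p653130 `…OsculationLawRankOneRoots` (`secular_comp_neg_X`, `card_fibre_roots_rankOne_neg`), p654481
`…OsculationLawRankOneMonic` (`toBiv_monic`) and p654523 `…OsculationLawRankOneResultant` (`osc_le_card_pos_roots_resultant`) — val-port-4 g2 /
val-lit-p5 g13.  O5 BLOCK-SUM — exact decoupling
identity `osculationSet_fromBlocks` and the RUNG `OsculationBlockSum.osculationLawAt_decoupled` (the LAW body for block-DECOUPLED letter tuples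
from the LAW bodies at the top splittings `(r,0)`, `r ≤ m`) — val-sym-trop-p4 g16, p645356 `…OsculationBlockSum`, p650063
`…OsculationBlockSumRung`, straddling form p648274 / p649424 / p649973 `…BlockSumStraddle{,Set,Count}` (`#osc ≤ #osc₁ + #osc₂ + #crossings`).  O6 WINDOW —
wired below (`rungOffWindow`, `rungBoundedK`, `osculationLaw_iff_window`).
-/

set_option linter.unusedVariables false

namespace Summit.ValiantsHypothesis.ValiantsHypothesis.Cruxes.MatrixDescartes.OsculationLaw

open Polynomial Matrix
open scoped BigOperators
open Summit.ValiantsHypothesis.ValiantsHypothesis.Theorems.LacunarySymmetroidMatrixDescartes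
  (RealRootLawAt KPlusLogSqLaw)
open Summit.ValiantsHypothesis.ValiantsHypothesis.Theorems.MatrixDescartes.Negative (PosRootLawAt)
open Summit.ValiantsHypothesis.ValiantsHypothesis.Theses.LacunarySymmetroid (MatrixDescartes)

/-! ## Objects -/

/-- The block projector `I_r ⊕ 0` (every PSD direction of rank `r` is congruent to it). -/
def blockProj (r s : ℕ) : Matrix (Fin r ⊕ Fin s) (Fin r ⊕ Fin s) ℝ :=
  Matrix.fromBlocks 1 0 0 0

/-- The insertion polynomial `Φ(t,b) = det(Σ_l t^(d l) • S l + b • (I_r ⊕ 0))`, variables `X 0 = t`, `X 1 = b`. -/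
noncomputable def insertionPoly {r s K : ℕ} (d : Fin K → ℕ)
    (S : Fin K → Matrix (Fin r ⊕ Fin s) (Fin r ⊕ Fin s) ℝ) : MvPolynomial (Fin 2) ℝ :=
  (∑ l, (MvPolynomial.X (0 : Fin 2) : MvPolynomial (Fin 2) ℝ) ^ d l •
      (S l).map (MvPolynomial.C : ℝ →+* MvPolynomial (Fin 2) ℝ)
    + (MvPolynomial.X (1 : Fin 2) : MvPolynomial (Fin 2) ℝ) •
      (blockProj r s).map (MvPolynomial.C : ℝ →+* MvPolynomial (Fin 2) ℝ)).det

/-- Euler operator `θ_i = X_i · ∂/∂X_i` (the derivative in the logarithmic coordinate `log |X_i|`). -/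
noncomputable def euler (i : Fin 2) (p : MvPolynomial (Fin 2) ℝ) : MvPolynomial (Fin 2) ℝ :=
  MvPolynomial.X i * MvPolynomial.pderiv i p

/-- Bordered log-Hessian: with `Ψ(u,w) = Φ(e^u, ±e^w)`, `H(Φ) = Ψ_uu Ψ_w² − 2 Ψ_uw Ψ_u Ψ_w + Ψ_ww Ψ_u²`
as a polynomial in `(t,b)`; it vanishes at a smooth point of `{Φ = 0}` iff the curve has zero curvature
there in the coordinates `(log t, log |b|)`, i.e. iff the curve OSCULATES a monomial arc `b = -c t^N`. -/
noncomputable def logHessian (p : MvPolynomial (Fin 2) ℝ) : MvPolynomial (Fin 2) ℝ :=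
  euler 0 (euler 0 p) * (euler 1 p) ^ 2 - 2 * euler 0 (euler 1 p) * euler 0 p * euler 1 p
    + euler 1 (euler 1 p) * (euler 0 p) ^ 2

/-- The osculation set of the spectral curve `Φ(t,b) = det(G(t) + bP) = 0` in the open quadrant `t > 0`, `b > 0`
(the quadrant met by the inserted letter: `det(G + c t^N P)(t) = Φ(t, c t^N)`, `c > 0`): the points of the curve
where the bordered log-Hessian vanishes — log-log inflection points of the eigenvalue branches, and every
singular point (branch crossing) of the curve. -/
def osculationSet {r s K : ℕ} (d : Fin K → ℕ)
    (S : Fin K → Matrix (Fin r ⊕ Fin s) (Fin r ⊕ Fin s) ℝ) : Set (Fin 2 → ℝ) :=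
  {p | 0 < p 0 ∧ 0 < p 1 ∧ MvPolynomial.eval p (insertionPoly d S) = 0 ∧
      MvPolynomial.eval p (logHessian (insertionPoly d S)) = 0}

/-- Positive zeros of a real polynomial counted WITH multiplicity (`0` for the zero polynomial). -/
noncomputable def posRootsMult (f : ℝ[X]) : ℕ :=
  Multiset.card (f.roots.filter (fun t => 0 < t))

/-- `det G` for the block pencil. -/
noncomputable def blockDet {r s K : ℕ} (d : Fin K → ℕ)
    (S : Fin K → Matrix (Fin r ⊕ Fin s) (Fin r ⊕ Fin s) ℝ) : ℝ[X] :=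
  (∑ l, (X : ℝ[X]) ^ d l • (S l).map Polynomial.C).det

/-- `det G₂₂` (the compression to the kernel of the projector). -/
noncomputable def lowerDet {r s K : ℕ} (d : Fin K → ℕ)
    (S : Fin K → Matrix (Fin r ⊕ Fin s) (Fin r ⊕ Fin s) ℝ) : ℝ[X] :=
  (∑ l, (X : ℝ[X]) ^ d l • ((S l).toBlocks₂₂).map Polynomial.C).det

/-- `det(G + c t^N P)`: the pencil with ONE MORE (semidefinite, rank `r`) letter inserted at position `N`. -/
noncomputable def insertedDet {r s K : ℕ} (d : Fin K → ℕ)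
    (S : Fin K → Matrix (Fin r ⊕ Fin s) (Fin r ⊕ Fin s) ℝ) (c : ℝ) (N : ℕ) : ℝ[X] :=
  (∑ l, (X : ℝ[X]) ^ d l • (S l).map Polynomial.C
    + (Polynomial.C c * (X : ℝ[X]) ^ N) • (blockProj r s).map Polynomial.C).det

/-- `θ = X·d/dX` on `ℝ[X]` and the logarithmic Wronskian `W(h) = h·θ²h − (θh)²` (`= h²·(log|h|)''` in `log t`). -/
noncomputable def eulerX (p : ℝ[X]) : ℝ[X] := X * derivative p
noncomputable def logWronskian (p : ℝ[X]) : ℝ[X] := p * eulerX (eulerX p) - eulerX p ^ 2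

/-! ## Statements -/

/-- **Peel inequality** (the convexity theorem; uniform in the scale `c` and the position `N`), stated in the
multiplicity currency for pencils in GENERAL POSITION: `det G ≢ 0`, `det G₂₂ ≢ 0`, finitely many osculation
points, each a smooth point of the curve (`∂_b Φ ≠ 0`: no branch crossing), none of them on the line `b = c t^N`.
(General position is format-open and dense; `stub_recursion` carries the reduction to it.) -/
def PeelInequality : Prop :=
  ∀ (r s K : ℕ) (d : Fin K → ℕ) (S : Fin K → Matrix (Fin r ⊕ Fin s) (Fin r ⊕ Fin s) ℝ) (c : ℝ) (N : ℕ),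
    (∀ l, (S l).IsSymm) → 0 < c → blockDet d S ≠ 0 → lowerDet d S ≠ 0 →
    (osculationSet d S).Finite →
    (∀ p ∈ osculationSet d S,
        MvPolynomial.eval p (MvPolynomial.pderiv 1 (insertionPoly d S)) ≠ 0 ∧ p 1 ≠ c * p 0 ^ N) →
      posRootsMult (insertedDet d S c N) ≤
        2 * (osculationSet d S).ncard + 2 * r + 2 * posRootsMult (blockDet d S) + 3 * posRootsMult (lowerDet d S)

/-- **Osculation law at a format**: the cusp budget for inserting a semidefinite letter into a symmetric
`(m,K)` pencil, over all block splittings `m = r + s`. -/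
def OsculationLawAt (m K B : ℕ) : Prop :=
  ∀ (r s : ℕ), r + s = m → ∀ (d : Fin K → ℕ) (S : Fin K → Matrix (Fin r ⊕ Fin s) (Fin r ⊕ Fin s) ℝ),
    (∀ l, (S l).IsSymm) → (osculationSet d S).Finite → (osculationSet d S).ncard ≤ B

/-- **OSCULATION LAW** (the format-level law of this line; Conjecture-B envelope). -/
def OsculationLaw : Prop := ∃ C : ℕ, ∀ m K : ℕ, OsculationLawAt m K (2 ^ (C * (K + Nat.log 2 m ^ 2)))

/-- Conjecture B in the positive-zeros currency. -/
def PosKPlusLogSqLaw : Prop := ∃ C : ℕ, ∀ m K : ℕ, PosRootLawAt m K (2 ^ (C * (K + Nat.log 2 m ^ 2)))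

/-! ## Stubs (registered targets of the line; `sorry` only here) -/

/-! ### `stub_peel`, r-indexed split (STAGED by val-port-1 g1 for the line owner val-idea-2, val-lit desk g11 RULING #262 (c′);
ranks `r = 1, 2` are landed THEOREMS — val-lit-p7 g12's `OsculationPeel.peelInequality_rankOne` (p610387/p610900 chain) and
`OsculationPeel.peelInequality_rankTwo` (p611283 chain) —, rank `0` is trivial, ranks `r ≥ 3` stay the open stub) -/

/-- `PeelInequality` at a FIXED top rank `r` (the body of `PeelInequality` with its first binder specialised; every other
binder token-for-token). -/
def PeelInequalityAt (r : ℕ) : Prop :=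
  ∀ (s K : ℕ) (d : Fin K → ℕ) (S : Fin K → Matrix (Fin r ⊕ Fin s) (Fin r ⊕ Fin s) ℝ) (c : ℝ) (N : ℕ),
    (∀ l, (S l).IsSymm) → 0 < c → blockDet d S ≠ 0 → lowerDet d S ≠ 0 →
    (osculationSet d S).Finite →
    (∀ p ∈ osculationSet d S,
        MvPolynomial.eval p (MvPolynomial.pderiv 1 (insertionPoly d S)) ≠ 0 ∧ p 1 ≠ c * p 0 ^ N) →
      posRootsMult (insertedDet d S c N) ≤
        2 * (osculationSet d S).ncard + 2 * r + 2 * posRootsMult (blockDet d S) + 3 * posRootsMult (lowerDet d S)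

/-- The split is exact: `PeelInequality` IS `∀ r, PeelInequalityAt r` (definitionally). -/
theorem peelInequality_iff_forall : PeelInequality ↔ ∀ r, PeelInequalityAt r := Iff.rfl

/-- Rank `0`: the inserted letter `c·t^N·(I₀ ⊕ 0)` is zero, so `insertedDet = blockDet` and the inequality is
`Z ≤ … + 2·Z + …`. [folklore] -/
theorem peelInequalityAt_zero : PeelInequalityAt 0 := by
  intro s K d S c N _ _ _ _ _ _
  have hP : blockProj 0 s = 0 := by
    ext i j
    rcases i with ⟨i⟩ | i
    · exact i.elim0
    · rcases j with ⟨j⟩ | j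
      · exact j.elim0
      · simp [blockProj, Matrix.fromBlocks_apply₂₂]
  have hins : insertedDet d S c N = blockDet d S := by
    simp only [insertedDet, blockDet, hP, Matrix.map_zero _ (map_zero Polynomial.C), smul_zero, add_zero]
  rw [hins]
  omega

/-- Rank `1` = val-lit-p7 g12's landed `OsculationPeel.peelInequality_rankOne` (statement = `PeelInequalityAt 1` with the
line's vocabulary unfolded verbatim; by-name citation, δ-unfold). -/
theorem peelInequalityAt_one : PeelInequalityAt 1 :=
  Theorems.LacunarySymmetroidMatrixDescartes.OsculationPeel.peelInequality_rankOne

/-- Rank `2` = val-lit-p7 g12's landed `OsculationPeel.peelInequality_rankTwo` (by-name citation, δ-unfold). -/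
theorem peelInequalityAt_two : PeelInequalityAt 2 :=
  Theorems.LacunarySymmetroidMatrixDescartes.OsculationPeel.peelInequality_rankTwo

/-- STUB 1♯ — **PROVED** (2026-08-28 11:18Z): the peel inequality at every top rank `r ≥ 3` is val-lit-p7 g13's landed
`OsculationPeel.peelInequality_rank_of_three_le` (p628379, `Theorems/…OsculationLawPeelRankThreeUp.lean`: the REGISTERED type
with the line's vocabulary unfolded verbatim; composition BY NAME of p4 g13's `peel_curve_of_endCost` p627559 — components
`exists_maximal_branch`, per-component `card_roots_on_branch_le`, end charges, `sum_card_le_card_roots` [p7 g12] — with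
p9 g2's `Literature.Algebra.Polynomial.AKLM.rootMultiplicity_zero_le_rootMultiplicity_coeff` ×2 p627268 and p7 g13's
`peelInequality_rank` p627583 over p5 g11's letter algebra).  By-name citation, δ-unfold only (desk RULING #283 (i);
wired by the line-file writer val-port-2 g1). -/
theorem stub_peelRankThreeUp : ∀ r : ℕ, 3 ≤ r → PeelInequalityAt r :=
  Theorems.LacunarySymmetroidMatrixDescartes.OsculationPeel.peelInequality_rank_of_three_le

/-- STUB 1 (L, the theorem of the line) — now a THEOREM, ASSEMBLED from the rank split: `r = 0` trivial, `r = 1, 2` landed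
theorems, `r ≥ 3` = `stub_peelRankThreeUp` (landed p628379); no `sorry` below this docstring.  `Φ(t,·)` is hyperbolic for every `t > 0` (symmetry: its roots are
minus the eigenvalues of the Schur complement `G/G₂₂(t)`), so by Rellich its `r` roots are real-analytic
BRANCHES `b_j(t)` on `t > 0` minus escape points; Vieta in a Möbius chart gives
`#(branch, zero) events ≤ Z₊mult(det G)` and `#escapes ≤ Z₊mult(det G₂₂)`; each branch's positive part splits
into `≤ zeros + escapes + 1` intervals and these into arcs at the osculation points; in `(log t, log b)` the
inserted letter is the line `w = N u + log c`, which meets a strictly convex/concave arc with total multiplicity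
`≤ 2`; the multiplicity of `det F = e₀·∏(c t^N − b_j)` not carried by branch contacts sits at poles and is
`≤ ord(e₀)`, i.e. charged once more to `Z₊mult(det G₂₂)`. -/
theorem stub_peel : PeelInequality := fun r =>
  match r with
  | 0 => peelInequalityAt_zero
  | 1 => peelInequalityAt_one
  | 2 => peelInequalityAt_two
  | (r + 3) => stub_peelRankThreeUp (r + 3) (by omega)

/-- STUB 2 (M, the resultant form at rank one).  For `r = 1`, `Φ = f + b·a` with `f = det G`, `a = det G₂₂`,
the branch is `b = -f/a` and its log-log curvature is `(W(f) a² − W(a) f²)/(f a)²`; hence the osculation count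
is at most the number of positive zeros of the explicit polynomial `W(f)·a² − W(a)·f²`. -/
theorem stub_rankOne (s K : ℕ) (d : Fin K → ℕ) (S : Fin K → Matrix (Fin 1 ⊕ Fin s) (Fin 1 ⊕ Fin s) ℝ)
    (hS : ∀ l, (S l).IsSymm) (hfin : (osculationSet d S).Finite) :
    (osculationSet d S).ncard ≤
      posRootsMult (logWronskian (blockDet d S) * lowerDet d S ^ 2
        - logWronskian (lowerDet d S) * blockDet d S ^ 2) := by
  -- LANDED (`…OsculationLawStubRankOne`, `OsculationRankOne.stub_rankOne`, line vocabulary unfolded verbatim): by-name citation, δ-unfold (stub-credit wiring val-port-1 g1, val-lit RULING #246 (a))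
  exact Summit.ValiantsHypothesis.ValiantsHypothesis.Theorems.LacunarySymmetroidMatrixDescartes.OsculationRankOne.stub_rankOne s K d S hS hfin

/-- STUB 3 (the LAW; open; Conjecture-B strength with a named mechanism). -/
theorem stub_osculationLaw : OsculationLaw := by
  sorry

/-- STUB 4 (bookkeeping + general position) — now a THEOREM, wired δ-only (val-lit RULING #287 (b)) to val-port-3 g1's
`GPDensity.recursion_holds` (`Theorems/…OsculationLawRecursionHolds.lean`; ROUTE′: crossing-tolerant peel at `s = 0` —
val-lit-p7 g13 `OsculationPeel.peelPrime` / sorted roots; node recursion in the multiplicity currency inside the HEREDITARY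
uniform-shift general-position family with ONE transfer per level — port-3 g1 `…DenseTransfer` / `…TransferStep` /
`…RecursionHereditary` / `…RecursionAssemblyPrime`, val-lit-p4 g13 `OsculationRecursion.zmult_node_le'`, val-lit-p8 g12
`…RecursionSplit` + SPEC R3–R5; density of that family by Zariski genericity along segments with the generic DIAGONAL witness —
port-3 g1 `GPDensity.gpNodeDensePrime`, val-lit-p6 g14 `OsculationGeneric.*` (D1/Dg/witness), val-lit-p5 g12
`OsculationUniform.*` (D2), val-lit-p7 g13 `arc0_cofinite` / `arc1_cofinite`).  The hypotheses are the line's `PeelInequality`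
(itself the theorem `stub_peel`; not consumed by the closer) and `OsculationLaw` (= `stub_osculationLaw`, the LAW, still `sorry`). -/
theorem stub_recursion (hP : PeelInequality) (hO : OsculationLaw) : PosKPlusLogSqLaw :=
  Summit.ValiantsHypothesis.ValiantsHypothesis.Theorems.LacunarySymmetroidMatrixDescartes.GPDensity.recursion_holds hP hO

/-- **RUNG TWO (stub credit, `m = 2`)** — `OsculationLawAt 2 K (16·K¹²)` is a landed THEOREM:
`Theorems/LacunarySymmetroidMatrixDescartesOsculationLawTwoK.lean` (`OsculationTwoK.osculationLawAt_two`, statement = this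
line's `OsculationLawAt` unfolded verbatim; by-name citation, δ-unfolding only).  Wired by tenure g11 (desk P6 (2), 2026-08-28). -/
theorem rungTwo (K : ℕ) : OsculationLawAt 2 K (16 * K ^ 12) :=
  Theorems.LacunarySymmetroidMatrixDescartes.OsculationTwoK.osculationLawAt_two K

/-- **RUNG THREE (stub credit, `m = 3`)** — `OsculationLawAt 3 K (17·K⁴¹)` is a landed THEOREM:
`Theorems/LacunarySymmetroidMatrixDescartesOsculationLawThreeK.lean` (`OsculationThreeK.osculationLawAt_three`, p613807,
val-lit-p5 g11 assembly over the (3,0) count p613007 (p6 g13), the (2,1) count and the rank-0/rank-1 columns; statement = this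
line's `OsculationLawAt` unfolded verbatim; by-name citation, δ-unfolding only).  Wired by val-port-1 g1 (val-lit desk g11
RULING #257 (a) / #262 (c), 2026-08-28); it closes no stub of the line (`stub_osculationLaw` is the ∀-format LAW). -/
theorem rungThree (K : ℕ) : OsculationLawAt 3 K (17 * K ^ 41) :=
  Theorems.LacunarySymmetroidMatrixDescartes.OsculationThreeK.osculationLawAt_three K

/-- **RUNG FOUR (stub credit, `m = 4`)** — `OsculationLawAt 4 K (22·K¹²⁴)` is a landed THEOREM:
`Theorems/LacunarySymmetroidMatrixDescartesOsculationLawFourK.lean` (`OsculationFourKRung.osculationLawAt_four`, p625650,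
assembled by val-lit-p5 g11 over the column theorems (0,4) `OsculationTwoK.osculationLawAt_rankZero`, (1,3)
`osculationLawAt_rankOne`, (2,2) `OsculationRankTwo.osc_two_s`, (3,1) `OsculationRankThree.osc_three_s`, (4,0)
`OsculationFourK.osc_four_zero` (val-lit-p6 g13 / p4 g13); statement = this line's `OsculationLawAt` unfolded verbatim;
by-name citation, δ-unfolding only).  Wired by val-port-1 g1 (val-lit desk g12, 2026-08-28).  HONEST LABEL: a rung
(`m = 4`, all `K`), not the law `stub_osculationLaw` (all `m`), which stays OPEN. -/
theorem rungFour (K : ℕ) : OsculationLawAt 4 K (22 * K ^ 124) :=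
  Theorems.LacunarySymmetroidMatrixDescartes.OsculationFourKRung.osculationLawAt_four K

/-- **RUNG ALL (every format `m`, every `K`)** — `OsculationLawAt m K (m·K^{20m²})` is a landed THEOREM:
`Theorems/LacunarySymmetroidMatrixDescartesOsculationLawUniformAll.lean` (`OsculationUniformRung.osculationLawAt_all`, p629687,
val-lit-p5 g12's UNIFORM CHAIN U1–U6: GcdRow p627879 · PosRoot p628117 · SubresultantSupport p628463 · `uniform_count` p628970 ·
`eval_logHessian_sum` p629310; δ-read PASS by val-lit-p6 g14); statement = this line's `OsculationLawAt` unfolded verbatim;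
by-name citation, δ-unfolding only.  Wired by val-port-2 g1 (val-lit desk g12 RULING #286, 2026-08-28).  It supersedes the
per-`m` rungs 2/3/4 above as an existence statement (they keep the sharper exponents) and closes the «every fixed m» ladder.
HONEST LABEL (desk #286): this is the ALL-`m` RUNG, NOT the LAW — `stub_osculationLaw` asks the QUASI-POLYNOMIAL bound
`2^{C (K + log₂² m)}` with `C` uniform in `m`, which `m·K^{20m²}` exceeds as soon as `m ≳ √K`; the LAW stays `sorry`
(the crux); sorries of this file stay 2. -/
theorem rungAll (m K : ℕ) : OsculationLawAt m K (m * K ^ (20 * m ^ 2)) :=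
  Theorems.LacunarySymmetroidMatrixDescartes.OsculationUniformRung.osculationLawAt_all m K

/-- **RUNG ALL, binomial exponent (stub credit; every format `m`, every `K`)** — `OsculationLawAt m K (m·multichoose(K, 20m²))`
is a landed THEOREM: val-lit-p5 g12's `OsculationUniformRung.osculationLawAt_all_multichoose` (p640643; the support count of
the uniform chain sharpened from `K^{20m²}` to `(K multichoose 20m²) = C(K + 20m² − 1, 20m²)`, i.e. polynomial in `K` of degree
`20m²` with the right leading constant).  Calibration (p5's RULING #290 (a) memo): still NOT the LAW — `log₂` of this budget is
`Θ(m² log K)`, not `O(K + log₂² m)` uniformly in `m`; `stub_osculationLaw` stays `sorry`.  δ-wiring only (val-port-2 g1). -/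
theorem rungAllMultichoose (m K : ℕ) : OsculationLawAt m K (m * Nat.multichoose K (20 * m ^ 2)) :=
  Summit.ValiantsHypothesis.ValiantsHypothesis.Theorems.LacunarySymmetroidMatrixDescartes.OsculationUniformRung.osculationLawAt_all_multichoose m K

/-- **RUNG OFF-WINDOW (stub credit; every format OUTSIDE `log₂ m < K < 20 m²`)** — the LAW's inequality with the explicit
constant `C = 11` holds whenever `K ≤ log₂ m` or `20 m² ≤ K`: a landed THEOREM, val-lit-p7 g14's
`OsculationWindow.osculationLawAt_offWindow` (`Theorems/LacunarySymmetroidMatrixDescartesOsculationLawWindow.lean`, p644942; pure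
arithmetic over the all-`m` Descartes rung `osculationLawAt_all_multichoose`, p640643).  Statement = this line's `OsculationLawAt`
unfolded verbatim; by-name citation, δ-unfolding only.  Wired by val-port-2 g2 (line-file pen, desk RULING #293 (b)). -/
theorem rungOffWindow (m K : ℕ) (hw : K ≤ Nat.log 2 m ∨ 20 * m ^ 2 ≤ K) :
    OsculationLawAt m K (2 ^ (11 * (K + Nat.log 2 m ^ 2))) :=
  Theorems.LacunarySymmetroidMatrixDescartes.OsculationWindow.osculationLawAt_offWindow m K hw

/-- **RUNG BOUNDED-`K` (stub credit; every `m`, every `K ≤ K₀`)** — the LAW restricted to pencils with at most `K₀` letters holds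
with a constant depending on `K₀` alone: val-lit-p7 g14's `OsculationWindow.osculationLawAt_of_le` (p644942).  So the LAW's open
content needs `K → ∞` (jointly with `m → ∞`, by `rungAll`).  δ-unfolding only. -/
theorem rungBoundedK (K₀ m K : ℕ) (hK : K ≤ K₀) :
    OsculationLawAt m K (2 ^ ((11 + 2 * K₀ + 20 * 4 ^ K₀) * (K + Nat.log 2 m ^ 2))) :=
  Theorems.LacunarySymmetroidMatrixDescartes.OsculationWindow.osculationLawAt_of_le K₀ m K hK

/-- **THE LAW IS ITS WINDOW (calibration of record).**  `OsculationLaw` (= `stub_osculationLaw`, the crux) is EQUIVALENT to its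
restriction to the formats `log₂ m < K < 20 m²`: `⇐` is val-lit-p7 g14's `OsculationWindow.osculationLaw_of_window`
(`Theorems/…OsculationLawWindowReduction.lean`; constant `C + 11`), `⇒` is restriction.  This is where the b122 idea wave and any
future line must work: `m → ∞` and `K → ∞` jointly inside the window, non-commuting letters (val-lit-p5 g12's memo
`NOTE-p5g12-18050-LAW-calibration.md` made kernel-checked).  δ-wiring + one-line restriction (val-port-2 g2). -/
theorem osculationLaw_iff_window :
    OsculationLaw ↔ ∃ C : ℕ, ∀ m K : ℕ, Nat.log 2 m < K → K < 20 * m ^ 2 →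
      OsculationLawAt m K (2 ^ (C * (K + Nat.log 2 m ^ 2))) :=
  ⟨fun ⟨C, hC⟩ => ⟨C, fun m K _ _ => hC m K⟩,
   fun h => Theorems.LacunarySymmetroidMatrixDescartes.OsculationWindow.osculationLaw_of_window h⟩

/-! ## Glue (kernel-checked) -/

/-- Positive currency to the all-real currency of `KPlusLogSqLaw` (reflection transfer + the `K = 0` corner). -/
theorem kPlusLogSqLaw_of_pos (h : PosKPlusLogSqLaw) : KPlusLogSqLaw := by
  obtain ⟨C, hC⟩ := h
  obtain ⟨C₀, hC₀⟩ := Theorems.KPlusLogSqLaw.kPlusLogSqLaw_offWindow 0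
  refine ⟨C₀ + C + 2, fun m K => ?_⟩
  rcases Nat.eq_zero_or_pos K with rfl | hK
  · have h0 := hC₀ m 0 (Or.inl (by simp))
    exact Theorems.LacunarySymmetroidMatrixDescartes.Census.realRootLawAt_mono (Nat.pow_le_pow_right (by norm_num)
      (Nat.mul_le_mul_right _ (by omega))) h0
  · have h1 := Theorems.LacunarySymmetroidMatrixDescartes.Census.realRootLawAt_of_posRootLawAt (hC m K)
    refine Theorems.LacunarySymmetroidMatrixDescartes.Census.realRootLawAt_mono ?_ h1
    have hX : 1 ≤ K + Nat.log 2 m ^ 2 := by omega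
    calc 2 * 2 ^ (C * (K + Nat.log 2 m ^ 2)) + 1
        ≤ 2 * 2 ^ (C * (K + Nat.log 2 m ^ 2)) + 2 ^ (C * (K + Nat.log 2 m ^ 2)) := by
          have : 1 ≤ 2 ^ (C * (K + Nat.log 2 m ^ 2)) := Nat.one_le_two_pow
          omega
      _ ≤ 2 ^ 2 * 2 ^ (C * (K + Nat.log 2 m ^ 2)) := by omega
      _ = 2 ^ (2 + C * (K + Nat.log 2 m ^ 2)) := by rw [pow_add]
      _ ≤ 2 ^ ((C₀ + C + 2) * (K + Nat.log 2 m ^ 2)) := by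
          apply Nat.pow_le_pow_right (by norm_num)
          nlinarith

/-- **Composition.**  The four stubs imply the crux `MatrixDescartes` (stmt-18050) BY NAME. -/
theorem matrixDescartes_of_stubs : MatrixDescartes :=
  Theorems.LacunarySymmetroidMatrixDescartes.Census.matrixDescartes_of_kPlusLogSqLaw (kPlusLogSqLaw_of_pos (stub_recursion stub_peel stub_osculationLaw))

end Summit.ValiantsHypothesis.ValiantsHypothesis.Cruxes.MatrixDescartes.OsculationLaw
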